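import Summits.Ventures.HodgeRepro2.T7SupportRegularOnePlace

/-!
# A second non-vacuity witness for rows 721–723: `d ≠ (1, 1)`, `P ≠ 1` (support, seat p1)

The twin of `T7SupportRegularWitness` (row 724) that EXERCISES the four binders which row 724 satisfies by the
choice `d = (1, 1)`, `P = 1` (t7-crit-1's precision W1, STATUS l. 16115 / l. 16118): here the orthogonal data are
`d = (1, 2)` (a definite form `x₀ȳ₀ + 2 x₁ȳ₁` with two DIFFERENT `σ`-fixed non-zero diagonal entries), the second
basis is `f₀ = (1, 1)`, `f₁ = (1, −1)` — NOT orthogonal for `h` (`h(f₀, f₁) = 1 − 2 = −1`) and not the standard basis —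
so that `P = [[1, 1], [1, −1]] ≠ 1` (`det P = −2`) and `disc' σ d f 0 = h(f₀, f₀) = 1 + 2 = 3 ≠ 1`. The isometries:

* (R) the real isometry `γR = [[1/3, −4/3], [2/3, 1/3]]` of `diag(1, 2)` (`a² + 2c² = 1`, `ab + 2cd = 0`,
  `b² + 2d² = 2`; `det = 1`, inverse `[[1/3, 4/3], [−2/3, 1/3]]`);
* (C) the complex isometry `γC = diag(i, 1) · γR = [[i/3, −4i/3], [2/3, 1/3]]`, entries moved by `σ` (`rotC_moved`).

The invariant of row 662 on the data: `γR f₀ = (−1, 1)`, so `c₀₀ = d₀ · (γR f₀)₀ = −1`, `N(c₀₀) = 1`, and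
`κ(γR) = N(c₀₀) / (d₀ · d′₀) = 1 / (1 · 3) = 1/3`; likewise `γC f₀ = (−i, 1)`, `N(−i) = 1`, `κ(γC) = 1/3` — both
`∉ {0, 1}` (`kappa_R`, `kappa_C`), hence `Regular P γ` by row 721's `regular_of_kappa` (`regular_R`, `regular_C`;
directly: the column `γR f₀ = (−1, 1)` of `γR · P` has no zero entry, `regular_R_direct`). The characters are again
`χA = det ∘ iotaA`, `ψB = (det ∘ iotaB)⁻¹`, both non-trivial — `ψB` at the element `eB = [[0, −1], [−1, 0]] ∈ torusB σ f`
(it acts on `f` by the norm-one scalars `(−1, 1)`: `eB f₀ = −f₀`, `eB f₁ = f₁`; `det eB = −1`) — with (C) on the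
norm-one scalars `z² · (z²)⁻¹ = 1` (`hC_T`); so `hmatch_of_central` yields x1's `hmatch` binder (`hmatch_R`, `hmatch_C`)
and row 723's `regular_GL_map_of_map_kappa` the regularity of the images at `(ψ₁, ψ₂) = (σ, σ)` (`regular_map_R`,
`regular_map_C`).

WHAT THIS ADDS TO ROW 724 (and supersedes nothing: row 724 stays the census witness of rows 721–723, and its
INDEX record's W1 wording stays the record of why this twin exists): every binder of rows 721–723 is now discharged
by a COMPUTATION on a datum where the choice does not trivialise it — `hd` (`σ 1 = 1`, `σ 2 = 2`), `hd0`, `hP` (the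
columns of a non-identity `P`), `hf0` (`disc′ = 3`), `IsIsom` for a form with unequal diagonal entries, `κ = 1/3`,
(C), non-triviality.
WHAT IT DOES NOT SHOW (row 724's paragraph, verbatim): the witness data are of ARCHIMEDEAN type — the DEFINITE form
(`d = (1, 2)` here, signature `(2, 0)`) of row 694's `U(2)`-type over `ℂ/ℝ` with its continuous conjugation — NOT a
non-archimedean completion, NOT the `(1, 1)`-signature of the seesaw at `ι₂ / ι₃`, and NOT a CM number field over a
totally real subfield (no number field, no places, no ring of integers occurs): the file says nothing about the
satisfiability of the set over `F = E_{v₁}` with the local second basis and the completion's `σ`, nor about the REAL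
datum of the line (`loc γ₀`, `μ_{A,v₁}`, `μ_{B,v₁}⁻¹`), nor about any number-field instance — the witness is a member
of the class the rows quantify over, not the member the dictionary names (that remains the `[W]` sentence of record,
crit-1 l. 15949 (d)); it is not cited for (a′), (b′), (N), (P), the real `X`, or HC_CM. [M]-level, referee-facing
(the census cites row 724 under (h⁗⁵); this twin beside it); the `[W]` column is unchanged; LEMMAS CLOSING THE STEP
0; §8(d): NO.
Blind lane: Mathlib + the HodgeRepro2 prefix; no sorry; axioms ⊆ {propext, Classical.choice, Quot.sound}.
-/

namespace Summit.Ventures.HodgeRepro2.T7SupportRegularWitnessTwo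

open Matrix Complex Summit.Ventures.HodgeRepro2.T7SupportTwoTorusInvariant
  Summit.Ventures.HodgeRepro2.Tier7.Line3.TorusSupport
  Summit.Ventures.HodgeRepro2.T7SupportRegularStabilizer
  Summit.Ventures.HodgeRepro2.T7SupportRegularTransport
  Summit.Ventures.HodgeRepro2.T7SupportRegularOnePlace

/-! ## The datum: `σ = conj`, `d = (1, 2)`, `f = ((1, 1), (1, −1))`, `P = [[1, 1], [1, −1]]` -/

/-- the involution: complex conjugation. -/
abbrev σT : ℂ →+* ℂ := starRingEnd ℂ

/-- the orthogonal data `d = (1, 2)`: two different `σ`-fixed non-zero entries. -/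
noncomputable def dT : Fin 2 → ℂ := ![1, 2]

/-- the second basis `f₀ = (1, 1)`, `f₁ = (1, −1)` — not orthogonal for `h`, not the standard basis. -/
noncomputable def fT : Fin 2 → Fin 2 → ℂ := ![![1, 1], ![1, -1]]

/-- the matrix `P` with columns `f₀`, `f₁`. -/
noncomputable def PT : Matrix (Fin 2) (Fin 2) ℂ := !![1, 1; 1, -1]

/-- `P⁻¹ = (1/2) · P`. -/
noncomputable def PTinv : Matrix (Fin 2) (Fin 2) ℂ := !![1 / 2, 1 / 2; 1 / 2, -1 / 2]

/-- `P · P⁻¹ = 1`. -/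
theorem PT_mul_PTinv : PT * PTinv = 1 := by
  ext i j
  fin_cases i <;> fin_cases j <;> simp [PT, PTinv, Matrix.mul_apply, Fin.sum_univ_two] <;> norm_num

/-- `P⁻¹ · P = 1`. -/
theorem PTinv_mul_PT : PTinv * PT = 1 := by
  ext i j
  fin_cases i <;> fin_cases j <;> simp [PT, PTinv, Matrix.mul_apply, Fin.sum_univ_two] <;> norm_num

/-- `P` as an element of `GL (Fin 2) ℂ`. -/
noncomputable def PU : GL (Fin 2) ℂ := ⟨PT, PTinv, PT_mul_PTinv, PTinv_mul_PT⟩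

/-- the matrix of `PU`. -/
theorem coe_PU : (PU : Matrix (Fin 2) (Fin 2) ℂ) = PT := rfl

/-- `P ≠ 1`. -/
theorem PU_ne_one : PU ≠ 1 := by
  intro h
  have := congrArg (fun g : GL (Fin 2) ℂ => (g : Matrix (Fin 2) (Fin 2) ℂ) 0 1) h
  simp [coe_PU, PT] at this

/-- `d` is `σ`-fixed: `σ 1 = 1`, `σ 2 = 2`. -/
theorem hd_T : ∀ i, σT (dT i) = dT i := by
  intro i
  fin_cases i <;> simp [dT, σT, map_ofNat]

/-- `d` has no zero entry. -/
theorem hd0_T : ∀ i, dT i ≠ 0 := by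
  intro i
  fin_cases i <;> simp [dT]

/-- `d₀ ≠ d₁`: the form is not a multiple of the standard one. -/
theorem dT_zero_ne_one : dT 0 ≠ dT 1 := by simp [dT]

/-- the discriminant of the second basis at `j = 0`: `h(f₀, f₀) = 1 + 2 = 3`. -/
theorem disc'_T : disc' σT dT fT 0 = 3 := by
  simp only [disc', herm, dT, fT, Fin.sum_univ_two, Matrix.cons_val_zero, Matrix.cons_val_one, map_one]
  norm_num

/-- … hence non-zero. -/
theorem hf0_T : disc' σT dT fT 0 ≠ 0 := by rw [disc'_T]; norm_num

/-- the second basis is NOT orthogonal: `h(f₀, f₁) = 1 − 2 = −1`. -/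
theorem herm_fT : herm σT dT (fT 0) (fT 1) = -1 := by
  simp only [herm, dT, fT, Fin.sum_univ_two, Matrix.cons_val_zero, Matrix.cons_val_one, map_one, map_neg]
  norm_num

/-- the columns of `P` are the second basis. -/
theorem hP_T : ∀ j, (PU : Matrix (Fin 2) (Fin 2) ℂ).col j = fT j := by
  intro j
  ext i
  fin_cases i <;> fin_cases j <;> simp [coe_PU, PT, fT, Matrix.col]

/-! ## Witness (R): the real isometry `[[1/3, −4/3], [2/3, 1/3]]` of `diag(1, 2)` -/

/-- the real isometry of `diag(1, 2)`. -/
noncomputable def rotR : Matrix (Fin 2) (Fin 2) ℂ := !![1 / 3, -4 / 3; 2 / 3, 1 / 3]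

/-- its inverse. -/
noncomputable def rotRinv : Matrix (Fin 2) (Fin 2) ℂ := !![1 / 3, 4 / 3; -2 / 3, 1 / 3]

/-- `rotR · rotRinv = 1`. -/
theorem rotR_mul_rotRinv : rotR * rotRinv = 1 := by
  ext i j
  fin_cases i <;> fin_cases j <;> simp [rotR, rotRinv, Matrix.mul_apply, Fin.sum_univ_two] <;> norm_num

/-- `rotRinv · rotR = 1`. -/
theorem rotRinv_mul_rotR : rotRinv * rotR = 1 := by
  ext i j
  fin_cases i <;> fin_cases j <;> simp [rotR, rotRinv, Matrix.mul_apply, Fin.sum_univ_two] <;> norm_num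

/-- the isometry as an element of `GL (Fin 2) ℂ`. -/
noncomputable def γR : GL (Fin 2) ℂ := ⟨rotR, rotRinv, rotR_mul_rotRinv, rotRinv_mul_rotR⟩

/-- the matrix of `γR`. -/
theorem coe_γR : (γR : Matrix (Fin 2) (Fin 2) ℂ) = rotR := rfl

/-- `γR` is an isometry of `x₀ȳ₀ + 2 x₁ȳ₁`: the polynomial identity
`(x₀ − 4x₁)(ȳ₀ − 4ȳ₁) + 2 (2x₀ + x₁)(2ȳ₀ + ȳ₁) = 9 (x₀ȳ₀ + 2 x₁ȳ₁)`. -/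
theorem isIsom_R : IsIsom σT dT rotR := by
  intro x y
  have h2 : σT 2 = 2 := map_ofNat σT 2
  have h3 : σT 3 = 3 := map_ofNat σT 3
  have h4 : σT 4 = 4 := map_ofNat σT 4
  simp only [herm, dT, Fin.sum_univ_two, one_mul, mulVec_two, rotR, Matrix.of_apply,
    Matrix.cons_val', Matrix.cons_val_zero, Matrix.cons_val_one, Matrix.empty_val',
    Matrix.cons_val_fin_one, map_add, map_mul, map_neg, map_div₀, map_one, h2, h3, h4]
  ring

/-- the invariant of witness (R): `γR f₀ = (−1, 1)`, `c₀₀ = −1`, `κ(γR) = N(−1) / (1 · 3) = 1/3`. -/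
theorem kappa_R : kappa σT dT fT rotR = 1 / 3 := by
  unfold kappa
  rw [disc'_T]
  simp only [nrm, cc, dT, fT, mulVec_two, rotR, Matrix.of_apply, Matrix.cons_val',
    Matrix.cons_val_zero, Matrix.cons_val_one, Matrix.empty_val', Matrix.cons_val_fin_one]
  norm_num [map_ofNat]

/-- `κ(γR) ≠ 0`. -/
theorem hκ0_R : kappa σT dT fT rotR ≠ 0 := by rw [kappa_R]; norm_num

/-- `κ(γR) ≠ 1`. -/
theorem hκ1_R : kappa σT dT fT rotR ≠ 1 := by rw [kappa_R]; norm_num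

/-- **the witness (R) for row 721's `regular_of_kappa`** on a datum with `d ≠ (1, 1)`, `P ≠ 1`. -/
theorem regular_R : Regular PU γR :=
  regular_of_kappa σT dT hd_T hd0_T fT hf0_T PU γR hP_T isIsom_R hκ0_R hκ1_R

/-- cross-check from the definition: the column `γR f₀ = (−1, 1)` of `γR · P` has no zero entry. -/
theorem regular_R_direct : Regular PU γR := by
  refine ⟨0, ?_, ?_⟩ <;> simp [coe_γR, coe_PU, rotR, PT, Matrix.mul_apply, Fin.sum_univ_two] <;> norm_num

/-! ## Witness (C): the complex isometry `diag(i, 1) · γR`, entries moved by `σ` -/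

/-- the complex isometry `[[i/3, −4i/3], [2/3, 1/3]]`. -/
noncomputable def rotC : Matrix (Fin 2) (Fin 2) ℂ := !![1 / 3 * I, -4 / 3 * I; 2 / 3, 1 / 3]

/-- its inverse `[[−i/3, 4/3], [2i/3, 1/3]]`. -/
noncomputable def rotCinv : Matrix (Fin 2) (Fin 2) ℂ := !![-1 / 3 * I, 4 / 3; 2 / 3 * I, 1 / 3]

/-- `rotC · rotCinv = 1`. -/
theorem rotC_mul_rotCinv : rotC * rotCinv = 1 := by
  ext i j
  fin_cases i <;> fin_cases j <;>
    simp [rotC, rotCinv, Matrix.mul_apply, Fin.sum_univ_two, Complex.ext_iff] <;> norm_num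

/-- `rotCinv · rotC = 1`. -/
theorem rotCinv_mul_rotC : rotCinv * rotC = 1 := by
  ext i j
  fin_cases i <;> fin_cases j <;>
    simp [rotC, rotCinv, Matrix.mul_apply, Fin.sum_univ_two, Complex.ext_iff] <;> norm_num

/-- the complex isometry as an element of `GL (Fin 2) ℂ`. -/
noncomputable def γC : GL (Fin 2) ℂ := ⟨rotC, rotCinv, rotC_mul_rotCinv, rotCinv_mul_rotC⟩

/-- the matrix of `γC`. -/
theorem coe_γC : (γC : Matrix (Fin 2) (Fin 2) ℂ) = rotC := rfl

/-- the entries of `γC` are moved by the involution: `σ (i/3) = −i/3 ≠ i/3`. -/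
theorem rotC_moved : σT (rotC 0 0) ≠ rotC 0 0 := by
  simp only [rotC, Matrix.of_apply, Matrix.cons_val', Matrix.cons_val_zero, Matrix.empty_val',
    Matrix.cons_val_fin_one, map_mul, map_div₀, Complex.conj_I, map_ofNat σT 3, map_one]
  intro h
  have : (2 / 3 : ℂ) * I = 0 := by linear_combination -h
  simp at this

/-- `γC` is an isometry of `x₀ȳ₀ + 2 x₁ȳ₁` (`i · ī = 1` on the first coordinate). -/
theorem isIsom_C : IsIsom σT dT rotC := by
  intro x y
  have h2 : σT 2 = 2 := map_ofNat σT 2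
  have h3 : σT 3 = 3 := map_ofNat σT 3
  have h4 : σT 4 = 4 := map_ofNat σT 4
  simp only [herm, dT, Fin.sum_univ_two, one_mul, mulVec_two, rotC, Matrix.of_apply,
    Matrix.cons_val', Matrix.cons_val_zero, Matrix.cons_val_one, Matrix.empty_val',
    Matrix.cons_val_fin_one, map_add, map_mul, map_neg, map_div₀, map_one, h2, h3, h4,
    Complex.conj_I]
  linear_combination (-1 / 9 : ℂ) * (x 0 * σT (y 0) - 4 * x 0 * σT (y 1) - 4 * x 1 * σT (y 0) +
    16 * x 1 * σT (y 1)) * Complex.I_sq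

/-- the invariant of witness (C): `γC f₀ = (−i, 1)`, `N(−i) = 1`, `κ(γC) = 1/3`. -/
theorem kappa_C : kappa σT dT fT rotC = 1 / 3 := by
  unfold kappa
  rw [disc'_T]
  simp only [nrm, cc, dT, fT, mulVec_two, rotC, Matrix.of_apply, Matrix.cons_val',
    Matrix.cons_val_zero, Matrix.cons_val_one, Matrix.empty_val', Matrix.cons_val_fin_one]
  simp only [mul_one, mul_neg, one_mul, map_add, map_mul, map_neg, map_div₀, Complex.conj_I,
    map_ofNat σT 3, map_ofNat σT 4, map_one]
  ring_nf
  simp [Complex.I_sq]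
  norm_num

/-- `κ(γC) ≠ 0`. -/
theorem hκ0_C : kappa σT dT fT rotC ≠ 0 := by rw [kappa_C]; norm_num

/-- `κ(γC) ≠ 1`. -/
theorem hκ1_C : kappa σT dT fT rotC ≠ 1 := by rw [kappa_C]; norm_num

/-- **the witness (C) for row 721's `regular_of_kappa`**. -/
theorem regular_C : Regular PU γC :=
  regular_of_kappa σT dT hd_T hd0_T fT hf0_T PU γC hP_T isIsom_C hκ0_C hκ1_C

/-! ## The characters and (C) on the norm-one scalars -/

/-- the character `χA = det ∘ iotaA`. -/
noncomputable def χA_T : torusA σT →* ℂˣ := Matrix.GeneralLinearGroup.det.comp (iotaA σT)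

/-- the character `ψB = (det ∘ iotaB)⁻¹`. -/
noncomputable def ψB_T : torusB σT fT →* ℂˣ := (Matrix.GeneralLinearGroup.det.comp (iotaB σT fT))⁻¹

/-- the norm-one diagonal element `diag(−1, 1)` of the first torus. -/
theorem diagNegOne_mem_torusA : (fun i : Fin 2 => if i = 0 then (-1 : ℂˣ) else 1) ∈ torusA σT := by
  refine (Subgroup.mem_pi Set.univ).2 fun i _ => (mem_normOne σT _).2 ?_
  fin_cases i <;> simp [nrm, σT]

/-- `χA` is not trivial: at `diag(−1, 1)` it is `−1`. -/
theorem χA_T_ne_one : χA_T ≠ 1 := by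
  intro h
  have := congrArg (fun φ : torusA σT →* ℂˣ => (φ ⟨_, diagNegOne_mem_torusA⟩ : ℂ)) h
  simp only [χA_T, MonoidHom.comp_apply, Matrix.GeneralLinearGroup.val_det_apply, MonoidHom.one_apply,
    Units.val_one] at this
  rw [show ((iotaA σT ⟨_, diagNegOne_mem_torusA⟩ : GL (Fin 2) ℂ) : Matrix (Fin 2) (Fin 2) ℂ) =
      Matrix.diagonal (fun i : Fin 2 => if i = 0 then (-1 : ℂ) else 1) from by
        ext i j
        simp [iotaA, diagUnitHom, diagUnit, Matrix.diagonal_apply]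
        split_ifs <;> simp_all] at this
  rw [Matrix.det_diagonal, Fin.prod_univ_two] at this
  norm_num at this

/-- the matrix `[[0, −1], [−1, 0]]` — it acts on `f` by `(−1, 1)`: `f₀ ↦ −f₀`, `f₁ ↦ f₁`. -/
noncomputable def eBT : Matrix (Fin 2) (Fin 2) ℂ := !![0, -1; -1, 0]

/-- `eBT · eBT = 1`. -/
theorem eBT_mul_eBT : eBT * eBT = 1 := by
  ext i j
  fin_cases i <;> fin_cases j <;> simp [eBT, Matrix.mul_apply, Fin.sum_univ_two]

/-- `eBT` as an element of `GL (Fin 2) ℂ`. -/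
noncomputable def eB : GL (Fin 2) ℂ := ⟨eBT, eBT, eBT_mul_eBT, eBT_mul_eBT⟩

/-- `eB` lies in the second torus of `f`: it acts on `f₀`, `f₁` by the norm-one scalars `−1`, `1`. -/
theorem eB_mem : eB ∈ torusB σT fT := by
  refine (mem_torusB σT fT eB).2 ⟨fun i => if i = 0 then (-1 : ℂ) else 1, ?_, ?_⟩
  · intro i; fin_cases i <;> simp [nrm, σT]
  · intro j
    ext i
    fin_cases i <;> fin_cases j <;>
      simp [eB, eBT, fT, Matrix.mulVec, dotProduct, Fin.sum_univ_two]

/-- `det eB = −1`. -/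
theorem det_eB : (Matrix.GeneralLinearGroup.det eB : ℂ) = -1 := by
  rw [Matrix.GeneralLinearGroup.val_det_apply]
  simp [eB, eBT, Matrix.det_fin_two]

/-- `ψB` is not trivial: at `eB` it is `det⁻¹ = −1`. -/
theorem ψB_T_ne_one : ψB_T ≠ 1 := by
  intro h
  have := congrArg (fun φ : torusB σT fT →* ℂˣ => (φ ⟨eB, eB_mem⟩ : ℂ)) h
  simp only [ψB_T, MonoidHom.inv_apply, MonoidHom.comp_apply, MonoidHom.one_apply, Units.val_one,
    Units.val_inv_eq_inv_val] at this
  rw [show iotaB σT fT ⟨eB, eB_mem⟩ = eB from rfl, det_eB] at this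
  norm_num at this

/-- `det (iotaA (scalarA z)) = z²`. -/
theorem det_iotaA_scalarA (z : ℂ) (hz : nrm σT z = 1) :
    (Matrix.GeneralLinearGroup.det (iotaA σT (scalarA σT z hz)) : ℂ) = z ^ 2 := by
  rw [Matrix.GeneralLinearGroup.val_det_apply, coe_iotaA_scalarA, Matrix.det_smul, Matrix.det_one,
    Fintype.card_fin, mul_one]

/-- `det (iotaB (scalarB z)) = z²`. -/
theorem det_iotaB_scalarB (z : ℂ) (hz : nrm σT z = 1) :
    (Matrix.GeneralLinearGroup.det (iotaB σT fT (scalarB σT fT z hz)) : ℂ) = z ^ 2 := by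
  rw [Matrix.GeneralLinearGroup.val_det_apply, coe_iotaB_scalarB, Matrix.det_smul, Matrix.det_one,
    Fintype.card_fin, mul_one]

/-- **(C) on the norm-one scalars**: `z² · (z²)⁻¹ = 1`. -/
theorem hC_T : ∀ (z : ℂ) (hz : nrm σT z = 1), χA_T (scalarA σT z hz) * ψB_T (scalarB σT fT z hz) = 1 := by
  intro z hz
  have hz0 : z ≠ 0 := ne_zero_of_nrm_eq_one σT hz
  apply Units.ext
  simp only [χA_T, ψB_T, MonoidHom.inv_apply, MonoidHom.comp_apply, Units.val_mul, Units.val_inv_eq_inv_val,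
    Units.val_one]
  rw [det_iotaA_scalarA, det_iotaB_scalarB, mul_inv_cancel₀ (pow_ne_zero 2 hz0)]

/-- **the witness (R) for `hmatch_of_central`** on the datum `(σ, d = (1, 2), f, P ≠ 1, γR, χA, ψB)`. -/
theorem hmatch_R :
    ∀ a b, (iotaA σT a)⁻¹ * γR * iotaB σT fT b = γR → χA_T a * ψB_T b = 1 :=
  hmatch_of_central σT fT hP_T (fun _ : Unit => γR) () regular_R χA_T ψB_T hC_T

/-- **the witness (C) for `hmatch_of_central`**. -/
theorem hmatch_C :
    ∀ a b, (iotaA σT a)⁻¹ * γC * iotaB σT fT b = γC → χA_T a * ψB_T b = 1 :=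
  hmatch_of_central σT fT hP_T (fun _ : Unit => γC) () regular_C χA_T ψB_T hC_T

/-! ## Row 723 at the two embeddings -/

/-- **the witness (R) for row 723** at `(ψ₁, ψ₂) = (σ, σ)`: `Regular (map σ P) (map σ γR)` with `map σ P ≠ 1`. -/
theorem regular_map_R : Regular (GeneralLinearGroup.map σT PU) (GeneralLinearGroup.map σT γR) :=
  regular_GL_map_of_map_kappa σT σT σT dT hd_T hd0_T fT hf0_T hP_T isIsom_R
    (by rw [coe_γR, kappa_R, map_div₀, map_one, map_ofNat]; norm_num)
    (by rw [coe_γR, kappa_R, map_div₀, map_one, map_ofNat]; norm_num)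

/-- **the witness (C) for row 723** at `(ψ₁, ψ₂) = (σ, σ)` — `map σ γC ≠ γC` (`rotC_moved`). -/
theorem regular_map_C : Regular (GeneralLinearGroup.map σT PU) (GeneralLinearGroup.map σT γC) :=
  regular_GL_map_of_map_kappa σT σT σT dT hd_T hd0_T fT hf0_T hP_T isIsom_C
    (by rw [coe_γC, kappa_C, map_div₀, map_one, map_ofNat]; norm_num)
    (by rw [coe_γC, kappa_C, map_div₀, map_one, map_ofNat]; norm_num)

end Summit.Ventures.HodgeRepro2.T7SupportRegularWitnessTwo
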